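import Literature.AlgebraicGeometry.AbelianSchemes.PolarizationLawOfSymplecticTowerReading
import Literature.AlgebraicGeometry.AbelianSchemes.IsLambdaOfAtOntoOfAmpleWitness
import Literature.AlgebraicGeometry.AbelianSchemes.IsLambdaOfAtMulAdd
import Literature.AlgebraicGeometry.AbelianSchemes.DualPairFibreDimEq
import Literature.AlgebraicGeometry.AbelianSchemes.PoincarePullbackKernelCountOfQuotient
import Literature.AlgebraicGeometry.AbelianSchemes.AbelianSchemeFixedPowBaseChange
import Literature.AlgebraicGeometry.HodgeTheory.AbelianVarietyHomTorsionScalarRigidity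
import Literature.AlgebraicGeometry.Motives.AbelianVarietyTorsionPointsCountProofs
import Literature.AlgebraicGeometry.Motives.AbelianVarietyDegree
import Literature.AlgebraicGeometry.Motives.AbelianVarietyTangentKillers
import Mathlib.RingTheory.RootsOfUnity.PrimitiveRoots
import HarnessLib

/-!
# The similitude law `h ≫ λ₂ ≫ h^∨ = λ₁ ≫ [ν]` read on two symplectic torsion towers WITH INDEPENDENT ROOTS OF UNITY, over `ℂ`
# ([MumfordAV1970] §19 Thm. 3, §20, §23; [Lang1983AbelianVarieties] VII §2; [Lan2013PELCompactifications] §1.3.6; [Lange2023AbelianVarietiesComplex] §2.4.1)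

Topic `AlgebraicGeometry/AbelianSchemes`, namespace `Literature.AlgebraicGeometry.AbelianSchemes.AbelianSchemeOver`.  THEOREMS ONLY (no definition, no named fact,
no `instance`, no notation, no `sorry`).  Cell `hodgecm-mathlib` (D-0151), F0∕P6 «MOD», «GO 500» half A line L5 (EHECKE closer `Lines/F0_P6a_StubEHECKE.lean` of
LA5-plan (g3); assemblers (O-R1) LA5-p01 (g3), (O-R2) A-p06 (g35)): **organ (ρ-SIM) §3** — ★ `PolarizationLawOfSymplecticTowerReading` (p850053) assumed the two towers
share their roots `ζ_M`; the L6 readings `Reads` give each complex fibre ITS OWN symplectic lift with ITS OWN primitive roots (LA5-plan (g3) 07:07:35Z: «(O-MP) cannot assert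
`Λ₁.ζ = Λ₂.ζ`»).  This file removes that hypothesis over `ℂ`: the ratio of the two root systems is a unit `s ∈ ẑ^×`, the comparison of `h ≫ λ₂ ≫ h^∨` with `λ₁ ≫ [ν]` then holds on
every `A₁[M]` up to the scalar `s_M`, torsion-scalar rigidity (★ `HodgeTheory.AbelianVariety.eq_or_eq_neg_of_isIsogeny_of_forall_torsionPoints_map_eq_pow`) forces `s = ±1`, and
AMPLENESS of both witnesses excludes `−1`.  A-p06 (g35); `--supports stmt-HodgeConjecture-24832`, count-neutral.  HONEST LABEL: HC_CM is proved only modulo the 7 printed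
citations (2 remaining: hLiu418 = stmt-HodgeConjecture-24832, h413 = stmt-HodgeConjecture-24833) until rung 0 closes; this file is generic and discharges none of them.

## Mathematics

`A₁, A₂` abelian schemes over `Spec ℂ` with dual pairs (unit pins), `λᵢ = Λ(𝒪(Θᵢ))` at the point with `Θᵢ` AMPLE, `h : A₁ → A₂` a dominant homomorphism with affine fibre map,
`ν ≥ 1`, and for every level `N ∣ M ≠ 0` symplectic level maps `lᵢ : (ℤ∕M)^{2g′} → Aᵢ[M](ℂ)` (`l₁` onto) with PRIMITIVE roots `ζᵢ_M`: `ē^{Θᵢ}_M(lᵢ x, lᵢ y) = ζᵢ_M^{E_δ(x,y)}`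
([Lan2013PELCompactifications] Lemma 1.3.6.5 ∕ ★ `SymplecticLift`), and a reading `h(l₁ x) = l₂(T̄ x)` with `E_δ(T̄x, T̄y) = ν E_δ(x, y)`.  (§2) `ζ₂_M = ζ₁_M^{s_M}` with `s_M` coprime to `M`
(Mathlib `IsPrimitiveRoot.eq_pow_of_pow_eq_one`, `pow_iff_coprime`), so `ē^{Θ₂}_M(h a, h b) = ē^{Θ₁}_M(a, b)^{s_M ν}`; (§3) hence `D^{h^*Θ₂}_Q ∼ D^{Θ₁}_{Q^{s_M ν}} ∼ D^{ν•Θ₁}_{Q^{s_M}}`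
for `Q ∈ A₁[M]` ([Lang1983AbelianVarieties] VII §2 Prop. 4, ★ `weilDiv_linEquiv_weilDiv_zpow_of_forall_weilPairingLevel_eq_zpow`; theorem of the square), so the values of
`L := h ≫ λ₂ ≫ h^∨ = Λ(𝒪(h^*Θ₂))` (★ `IsLambdaOfAt.pullback_dualIsogeny`) and `L′ := λ₁ ≫ [ν] = Λ(𝒪(ν•Θ₁))` (★ `IsLambdaOfAt.pow_nsmul`) satisfy `L(Q) = L′(Q^{s_M}) = L′(Q)^{s_M}` on
`A₁[M](ℂ)` (§1, two-point form of ★ `valueAt_eq_valueAt_of_weilDiv_linEquiv`: «a point of `Â` is determined by its 𝒫-slice», [MilneAV2008] I §8); (§4) `L′` restricted to the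
fibre is an isogeny (`Θ₁` ample: ★ `IsLambdaOfAt.isIsogeny_fibreHom_of_isAmple_of_dim_eq`; `[ν]` an isogeny in characteristic `0`), so by TORSION-SCALAR RIGIDITY
([Lange2023AbelianVarietiesComplex] §2.4.1 ∕ [MumfordAV1970] §19 Thm. 3; ★ `eq_or_eq_neg_of_isIsogeny_of_forall_torsionPoints_map_eq_pow`) `L|_{A₁} = ±L′|_{A₁}`; if the sign
were `−`, then `L·L′ = Λ(𝒪(h^*Θ₂ + ν•Θ₁))` (★ `IsLambdaOfAt.mul_add`) would kill every point, while an AMPLE witness has finite kernel (★ `IsLambdaOfAt.finite_setOf_map_fibreHom_eq_one`;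
`h^*Θ₂ + ν•Θ₁` ample by ★ `IsAmple.pullback`∕`smul`∕`add`) — impossible in positive dimension (`#A₁[n](ℂ) = n^{2 dim}`, ★ `natCard_torsionPoints_eq_of_isAlgClosed`), and in
dimension `0` the torsion points are trivial so `L|_{A₁} = L′|_{A₁}` anyway (★ `hom_eq_of_forall_torsionPoints_map`).  Finally `L = L′` over `Spec ℂ` (★ `overPullbackIdIso`).

## Contents
* §1 `valueAt_eq_valueAt_of_weilDiv_linEquiv₂` (two points), `map_fibreHom_eq_map_fibreHom_of_valueAt_eq`;
* §2 `exists_coprime_root_pow_eq` (`ζ₂ = ζ₁^s`), `weilPairingLevel_map_eq_pow_mul_of_towerReading` (independent roots ⇒ exponent `s·ν`);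
* §3 `weilDiv_pullback_linEquiv_nsmul_pow_of_weilPairingLevel` (`D^{h^*Θ₂}_Q ∼ D^{ν•Θ₁}_{Q^s}`);
* §4 `fibreHom_eq_of_fibreHom_eq_or_eq_neg_of_isAmple` (sign exclusion), **`comp_lam_comp_dualIsogenyOver_eq_mulN_of_towerReadings`** — THE HEAD.

## References
* [MumfordAV1970] D. Mumford, *Abelian Varieties* (1970), §6 Appl. 3, §8 Thm. 1 (p. 77), §19 Thm. 3 (p. 176), §20 (pp. 183–186), §23 (Thm. 2, p. 231).
* [Lang1983AbelianVarieties] S. Lang, *Abelian Varieties* (1983), Ch. VII §2 Prop. 3–4.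
* [Lan2013PELCompactifications] K.-W. Lan, *Arithmetic compactifications of PEL-type Shimura varieties* (2013), §1.3.6 Def. 1.3.6.1–2, Lemma 1.3.6.5 (pp. 79–81).
* [Lange2023AbelianVarietiesComplex] H. Lange, *Abelian Varieties over the Complex Numbers* (2023), §2.4.1 Cor. 2.4.11 (PDF p. 117).
* [MilneAV2008] J. S. Milne, *Abelian Varieties* (2008), I §8 pp. 36–37.  [Milne2005ShimuraVarieties] §6 p. 75.
* Tree: ★ `PolarizationLawOfSymplecticTowerReading`, ★ `IsLambdaOfAtRigidityOnTorsion`, ★ `HodgeTheory/AbelianVarietyHomTorsionScalarRigidity`, ★ `IsLambdaOfAtOntoOfAmpleWitness`.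
-/

set_option autoImplicit false

noncomputable section

universe u

open CategoryTheory CategoryTheory.Limits AlgebraicGeometry MonoidalCategory
open scoped MonObj

namespace Literature.AlgebraicGeometry.AbelianSchemes

namespace AbelianSchemeOver

open Literature.AlgebraicGeometry.Motives Literature.AlgebraicGeometry.AbelianVarieties Literature.AlgebraicGeometry.Modules

/-! ### §1 Two-point rigidity of values -/

section TwoPoint

variable {S : Scheme.{u}} {A : AbelianSchemeOver S} (D : A.DualPair) (L L' : A.X ⟶ D.hat.X)
  {Ω : Type u} [Field Ω] (s : Spec (.of Ω) ⟶ S)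

/-- **`L̄(Q₁) = L̄′(Q₂)`** as points of `Â` when `L = Λ(𝒪(Θ))`, `L′ = Λ(𝒪(Θ′))` at `s` and `D^Θ_{Q₁} ∼ D^{Θ′}_{Q₂}` (two-point form of ★ `valueAt_eq_valueAt_of_weilDiv_linEquiv`).
[cite: MumfordFogartyKirwan1994, Ch. 6 §2 Definition 6.2–6.3 (p. 120)] [cite: MilneAV2008, I §8 pp. 36–37] [cite: GortzWedhorn2020, Prop. 11.21 (p. 374)] -/
theorem valueAt_eq_valueAt_of_weilDiv_linEquiv₂ {Θ Θ' : CartierDivisor (A.fibre s).toAbelianVariety.X.left}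
    (hΘ : A.IsLambdaOfAt s D L Θ) (hΘ' : A.IsLambdaOfAt s D L' Θ') (Q₁ Q₂ : (A.fibre s).toAbelianVariety.Points Ω)
    (h : ((A.fibre s).toAbelianVariety.weilDiv Θ Q₁).LinEquiv ((A.fibre s).toAbelianVariety.weilDiv Θ' Q₂)) :
    A.valueAt s D L Q₁ = A.valueAt s D L' Q₂ := by
  obtain ⟨i⟩ := AbelianSchemeOver.IsLambdaOfAt.nonempty_iso A s D L hΘ Q₁
  obtain ⟨i'⟩ := AbelianSchemeOver.IsLambdaOfAt.nonempty_iso A s D L' hΘ' Q₂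
  have h₁ := hasRank_translateTensorDual (A := A) s Θ Q₁
  have h₂ := hasRank_translateTensorDual (A := A) s Θ' Q₂
  have h₁f : IsFiniteLocallyFree (tensorObj
      ((Scheme.Modules.pullback ((A.fibre s).toAbelianVariety.translation Q₁).left).obj (A.lineBundleOfDivisor s Θ))
      (Modules.dual (A.lineBundleOfDivisor s Θ))) := HasRank.isFiniteLocallyFree' h₁
  have h₂f : IsFiniteLocallyFree (tensorObj
      ((Scheme.Modules.pullback ((A.fibre s).toAbelianVariety.translation Q₂).left).obj (A.lineBundleOfDivisor s Θ'))
      (Modules.dual (A.lineBundleOfDivisor s Θ'))) := HasRank.isFiniteLocallyFree' h₂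
  have e : Nonempty (tensorObj
      ((Scheme.Modules.pullback ((A.fibre s).toAbelianVariety.translation Q₁).left).obj (A.lineBundleOfDivisor s Θ))
      (Modules.dual (A.lineBundleOfDivisor s Θ)) ≅
    tensorObj
      ((Scheme.Modules.pullback ((A.fibre s).toAbelianVariety.translation Q₂).left).obj (A.lineBundleOfDivisor s Θ'))
      (Modules.dual (A.lineBundleOfDivisor s Θ'))) := by
    rw [nonempty_iso_iff_detClass_eq h₁ h₂ h₁f h₂f, detClass_translateTensorDual_eq_cechClass_weilDiv _ Θ Q₁ h₁f,
      detClass_translateTensorDual_eq_cechClass_weilDiv _ Θ' Q₂ h₂f, CartierDivisor.cechClass_eq_iff_linEquiv]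
    exact h
  obtain ⟨e⟩ := e
  have k₁ : Nonempty (D.pullbackP s (A.valueAt s D L Q₁) (A.valueAt_comp_hom s D L Q₁) ≅
      (D.sliceBundle (A.valueAt s D L' Q₂) s (A.valueAt_comp_hom s D L' Q₂)).L) := ⟨i ≪≫ e ≪≫ i'.symm⟩
  have k₂ : Nonempty (D.pullbackP s (A.valueAt s D L' Q₂) (A.valueAt_comp_hom s D L' Q₂) ≅
      (D.sliceBundle (A.valueAt s D L' Q₂) s (A.valueAt_comp_hom s D L' Q₂)).L) := ⟨Iso.refl _⟩
  exact D.eq_of_nonempty_iso s (D.sliceBundle (A.valueAt s D L' Q₂) s (A.valueAt_comp_hom s D L' Q₂))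
    (D.sliceBundle_fibrewisePicZero _ s _) _ _ (A.valueAt_comp_hom s D L Q₁) (A.valueAt_comp_hom s D L' Q₂) k₁ k₂

/-- Two points of `Â_s` with the same point of `Â` underneath are equal: `L_s(Q₁) = L′_s(Q₂)` from `L̄(Q₁) = L̄′(Q₂)`. [cite: GortzWedhorn2020, Section (4.7) (p. 135)] -/
theorem map_fibreHom_eq_map_fibreHom_of_valueAt_eq [IsMonHom L] [IsMonHom L'] (Q₁ Q₂ : (A.fibre s).toAbelianVariety.Points Ω)
    (h : A.valueAt s D L Q₁ = A.valueAt s D L' Q₂) :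
    AlgPoints.map (fibreHom L s).hom.hom.hom Q₁ = AlgPoints.map (fibreHom L' s).hom.hom.hom Q₂ := by
  apply Over.OverMorphism.ext
  apply pullback.hom_ext
  · have h1 := left_comp_pullback_map_comp_fst (A := A) s L Q₁
    have h2 := left_comp_pullback_map_comp_fst (A := A) s L' Q₂
    rw [fibreHom_hom_hom_hom, fibreHom_hom_hom_hom, AlgPoints.map_apply, AlgPoints.map_apply]
    exact h1.trans ((show A.fibrePointToLeft s Q₁ ≫ L.left = A.fibrePointToLeft s Q₂ ≫ L'.left from h).trans h2.symm)
  · exact (Over.w (Q₁ ≫ (Over.pullback s).map L)).trans (Over.w (Q₂ ≫ (Over.pullback s).map L')).symm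

end TwoPoint

/-! ### §2 Independent roots: `ζ₂ = ζ₁^s`, and the pairing identity with exponent `s·ν` -/

/-- **Two primitive `M`-th roots of unity differ by a unit exponent**: `ζ₂ = ζ₁^s` with `s` coprime to `M`. [cite: Lan2013PELCompactifications, §1.3.6 Def. 1.3.6.1 (pp. 79–80)] -/
theorem exists_coprime_root_pow_eq {Ω : Type u} [Field Ω] {M : ℕ} (hM : M ≠ 0) {ζ₁ ζ₂ : Ω} (h₁ : IsPrimitiveRoot ζ₁ M) (h₂ : IsPrimitiveRoot ζ₂ M) :
    ∃ s : ℕ, s.Coprime M ∧ ζ₁ ^ s = ζ₂ := by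
  haveI : NeZero M := ⟨hM⟩
  obtain ⟨s, -, hs⟩ := h₁.eq_pow_of_pow_eq_one h₂.pow_eq_one
  refine ⟨s, ?_, hs⟩
  have := (h₁.pow_iff_coprime (Nat.pos_of_ne_zero hM) s).mp (hs ▸ h₂)
  exact this

variable {A₁ A₂ : AbelianSchemeOver (Spec (.of ℂ))} (h : A₁.X ⟶ A₂.X) [IsMonHom h]

/-- **INDEPENDENT ROOTS ⇒ EXPONENT `s·ν`**: with symplectic level maps `l₁ ↠ A₁[M]`, `l₂ → A₂[M]` for `Θ₁`, `Θ₂` with roots `ζ₁`, `ζ₂ = ζ₁^s` (`ζᵢ^M = 1`) and a reading `h(l₁ x) = l₂(T̄ x)`,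
`E_δ(T̄x,T̄y) = ν E_δ(x,y)`: `ē^{Θ₂}_M(h a, h b) = ē^{Θ₁}_M(a, b)^{s·ν}` on `A₁[M](ℂ)`. [cite: Lan2013PELCompactifications, §1.3.6 Lemma 1.3.6.5 (p. 81)] [cite: MumfordAV1970, §20 (p. 186)] -/
theorem weilPairingLevel_map_eq_pow_mul_of_towerReading {M : ℕ} (hMΩ : (M : ℂ) ≠ 0) {g' : ℕ} (δ : Fin g' → ℕ) (ν s : ℕ) {ζ₁ ζ₂ : ℂ} (hζ₁ : ζ₁ ^ M = 1)
    (hζ₂ : ζ₂ ^ M = 1) (hs : ζ₁ ^ s = ζ₂)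
    (Θ₁ : CartierDivisor (A₁.fibre (𝟙 _)).toAbelianVariety.X.left) (Θ₂ : CartierDivisor (A₂.fibre (𝟙 _)).toAbelianVariety.X.left)
    (l₁ : (Fin g' ⊕ Fin g' → ZMod M) → (A₁.fibre (𝟙 _)).toAbelianVariety.torsionPoints ℂ M) (hl₁ : Function.Surjective l₁)
    (l₂ : (Fin g' ⊕ Fin g' → ZMod M) → (A₂.fibre (𝟙 _)).toAbelianVariety.torsionPoints ℂ M)
    (he₁ : haveI := (A₁.fibre (𝟙 _)).toAbelianVariety.isDominant_toSchemeHom_zsmul_of_ne_zero hMΩ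
      ∀ x y, (A₁.fibre (𝟙 _)).toAbelianVariety.weilPairingLevel Θ₁ (l₁ x) (l₁ y) = ζ₁ ^ (typeFormMod δ M x y).val)
    (he₂ : haveI := (A₂.fibre (𝟙 _)).toAbelianVariety.isDominant_toSchemeHom_zsmul_of_ne_zero hMΩ
      ∀ x y, (A₂.fibre (𝟙 _)).toAbelianVariety.weilPairingLevel Θ₂ (l₂ x) (l₂ y) = ζ₂ ^ (typeFormMod δ M x y).val)
    (T : (Fin g' ⊕ Fin g' → ZMod M) → (Fin g' ⊕ Fin g' → ZMod M))
    (hT : ∀ x, AlgPoints.map (fibreHom h (𝟙 _)).hom.hom.hom (l₁ x).1 = (l₂ (T x)).1)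
    (hν : ∀ x y, typeFormMod δ M (T x) (T y) = (ν : ZMod M) * typeFormMod δ M x y) :
    haveI := (A₁.fibre (𝟙 _)).toAbelianVariety.isDominant_toSchemeHom_zsmul_of_ne_zero hMΩ
    haveI := (A₂.fibre (𝟙 _)).toAbelianVariety.isDominant_toSchemeHom_zsmul_of_ne_zero hMΩ
    ∀ a b : (A₁.fibre (𝟙 _)).toAbelianVariety.torsionPoints ℂ M,
      (A₂.fibre (𝟙 _)).toAbelianVariety.weilPairingLevel Θ₂
          ⟨AlgPoints.map (fibreHom h (𝟙 _)).hom.hom.hom a.1, AbelianVariety.map_mem_torsionPoints (fibreHom h (𝟙 _)) a.2⟩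
          ⟨AlgPoints.map (fibreHom h (𝟙 _)).hom.hom.hom b.1, AbelianVariety.map_mem_torsionPoints (fibreHom h (𝟙 _)) b.2⟩ =
        (A₁.fibre (𝟙 _)).toAbelianVariety.weilPairingLevel Θ₁ a b ^ (s * ν) := by
  haveI : NeZero M := ⟨by rintro rfl; exact hMΩ (by simp)⟩
  intro a b
  obtain ⟨x, rfl⟩ := hl₁ a
  obtain ⟨y, rfl⟩ := hl₁ b
  have ha : (⟨AlgPoints.map (fibreHom h (𝟙 _)).hom.hom.hom (l₁ x).1, AbelianVariety.map_mem_torsionPoints (fibreHom h (𝟙 _)) (l₁ x).2⟩ :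
      (A₂.fibre (𝟙 _)).toAbelianVariety.torsionPoints ℂ M) = l₂ (T x) := Subtype.ext (hT x)
  have hb : (⟨AlgPoints.map (fibreHom h (𝟙 _)).hom.hom.hom (l₁ y).1, AbelianVariety.map_mem_torsionPoints (fibreHom h (𝟙 _)) (l₁ y).2⟩ :
      (A₂.fibre (𝟙 _)).toAbelianVariety.torsionPoints ℂ M) = l₂ (T y) := Subtype.ext (hT y)
  rw [ha, hb, he₂, hν, he₁, pow_val_natCast_mul hζ₂, ← hs, ← pow_mul, ← pow_mul, ← pow_mul]
  congr 1
  ring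

/-! ### §3 The divisor congruence with a twisted point: `D^{h^*Θ₂}_Q ∼ D^{ν•Θ₁}_{Q^s}` -/

/-- **ONE LEVEL, TWISTED**: if `ē^{Θ₂}_M(h a, h Q) = ē^{Θ₁}_M(a, Q)^{s·ν}` for all `a ∈ A₁[M]` then `D^{h^*Θ₂}_Q ∼ D^{ν•Θ₁}_{Q^s}` (Lang VII §2 Prop. 4 ∕ ★
`weilDiv_linEquiv_weilDiv_zpow_of_forall_weilPairingLevel_eq_zpow`, then the theorem of the square `D^{Θ₁}_{Q^{sν}} ∼ ν•D^{Θ₁}_{Q^s} ∼ D^{ν•Θ₁}_{Q^s}`).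
[cite: Lang1983AbelianVarieties, Ch. VII §2 Prop. 3 and Prop. 4] [cite: MumfordAV1970, §20 property (3) (p. 186)] -/
theorem weilDiv_pullback_linEquiv_nsmul_pow_of_weilPairingLevel
    [IsDominant (AbelianVariety.Hom.toSchemeHom (fibreHom h (𝟙 (Spec (.of ℂ)))))] (ν s : ℕ) {M : ℕ} (hMΩ : (M : ℂ) ≠ 0)
    (Θ₁ : CartierDivisor (A₁.fibre (𝟙 _)).toAbelianVariety.X.left) (Θ₂ : CartierDivisor (A₂.fibre (𝟙 _)).toAbelianVariety.X.left)
    (Q : (A₁.fibre (𝟙 _)).toAbelianVariety.torsionPoints ℂ M)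
    (hpair : haveI := (A₁.fibre (𝟙 _)).toAbelianVariety.isDominant_toSchemeHom_zsmul_of_ne_zero hMΩ
      haveI := (A₂.fibre (𝟙 _)).toAbelianVariety.isDominant_toSchemeHom_zsmul_of_ne_zero hMΩ
      ∀ a : (A₁.fibre (𝟙 _)).toAbelianVariety.torsionPoints ℂ M,
        (A₂.fibre (𝟙 _)).toAbelianVariety.weilPairingLevel Θ₂
            ⟨AlgPoints.map (fibreHom h (𝟙 _)).hom.hom.hom a.1, AbelianVariety.map_mem_torsionPoints (fibreHom h (𝟙 _)) a.2⟩
            ⟨AlgPoints.map (fibreHom h (𝟙 _)).hom.hom.hom Q.1, AbelianVariety.map_mem_torsionPoints (fibreHom h (𝟙 _)) Q.2⟩ =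
          (A₁.fibre (𝟙 _)).toAbelianVariety.weilPairingLevel Θ₁ a Q ^ (s * ν)) :
    ((A₁.fibre (𝟙 _)).toAbelianVariety.weilDiv (Θ₂.pullback (AbelianVariety.Hom.toSchemeHom (fibreHom h (𝟙 _)))) Q.1).LinEquiv
      ((A₁.fibre (𝟙 _)).toAbelianVariety.weilDiv (ν • Θ₁) (Q.1 ^ s)) := by
  haveI := (A₁.fibre (𝟙 _)).toAbelianVariety.isDominant_toSchemeHom_zsmul_of_ne_zero hMΩ
  haveI := (A₂.fibre (𝟙 _)).toAbelianVariety.isDominant_toSchemeHom_zsmul_of_ne_zero hMΩ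
  have h1 : ((A₁.fibre (𝟙 _)).toAbelianVariety.weilDiv (Θ₂.pullback (AbelianVariety.Hom.toSchemeHom (fibreHom h (𝟙 _)))) Q.1).LinEquiv
      ((A₁.fibre (𝟙 _)).toAbelianVariety.weilDiv Θ₁ (Q.1 ^ ((s * ν : ℕ) : ℤ))) := by
    refine AbelianVariety.weilDiv_linEquiv_weilDiv_zpow_of_forall_weilPairingLevel_eq_zpow hMΩ Θ₁ _ Q ((s * ν : ℕ) : ℤ) fun a => ?_
    rw [AbelianVariety.weilPairingLevel_pullback (fibreHom h (𝟙 _)) Θ₂ a Q, zpow_natCast]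
    exact hpair a
  rw [zpow_natCast, pow_mul] at h1
  exact h1.trans (((A₁.fibre (𝟙 _)).toAbelianVariety.nsmul_weilDiv_linEquiv Θ₁ (Q.1 ^ s) ν).symm.trans
    ((A₁.fibre (𝟙 _)).toAbelianVariety.weilDiv_nsmul_linEquiv Θ₁ (Q.1 ^ s) ν).symm)

/-! ### §4 Sign exclusion by ampleness, and THE HEAD -/

/-- **AMPLENESS EXCLUDES THE SIGN**: if `L = Λ(𝒪(Θ))`, `L′ = Λ(𝒪(Θ′))` at the point of `Spec ℂ` with `Θ`, `Θ′` such that `Θ + Θ′` is AMPLE, and `L_s = L′_s ∨ L_s = −L′_s` on the fibre, then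
`L_s = L′_s`: in the second case `(L·L′)_s = Λ(𝒪(Θ + Θ′))_s` (★ `IsLambdaOfAt.mul_add`) kills every point, so the finite kernel of an ample witness (★
`IsLambdaOfAt.finite_setOf_map_fibreHom_eq_one`) is all of `A_s(ℂ)`, which bounds `#A_s[n](ℂ) = n^{2 dim}` ([MumfordAV1970] §6 Appl. 3) and forces `dim A_s = 0`, where every torsion point
is trivial and homomorphisms are determined on torsion ([MumfordAV1970] §19 Thm. 3, ★ `hom_eq_of_forall_torsionPoints_map`).
[cite: MumfordAV1970, §6 Application 3 (p. 64), §8 Thm. 1 (p. 77), §19 Thm. 3 (p. 176)] [cite: Lange2023AbelianVarietiesComplex, §2.4.1 Cor. 2.4.11 (PDF p. 117)] -/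
theorem fibreHom_eq_of_fibreHom_eq_or_eq_neg_of_isAmple {A : AbelianSchemeOver (Spec (.of ℂ))} (D : A.DualPair)
    (hD : Nonempty ((Scheme.Modules.pullback (DualPair.unitHatSlice D)).obj D.P ≅ SheafOfModules.unit _)) (L L' : A.X ⟶ D.hat.X)
    [IsMonHom L] [IsMonHom L'] {Θ Θ' : CartierDivisor (A.fibre (𝟙 _)).toAbelianVariety.X.left}
    (hΘ : A.IsLambdaOfAt (𝟙 _) D L Θ) (hΘ' : A.IsLambdaOfAt (𝟙 _) D L' Θ') (hamp : (Θ + Θ').IsAmple)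
    (hor : fibreHom L (𝟙 _) = fibreHom L' (𝟙 _) ∨ fibreHom L (𝟙 _) = -fibreHom L' (𝟙 _)) :
    fibreHom L (𝟙 _) = fibreHom L' (𝟙 _) := by
  rcases hor with hor | hor
  · exact hor
  -- the product `L·L′` is `Λ(𝒪(Θ + Θ′))` and kills every point of the fibre
  haveI : IsCommMonObj D.hat.X := D.hat.isCommMonObj_of_isReduced_base
  haveI : IsMonHom (L * L') := AbelianSchemeOver.isMonHom_mul D.hat L L'
  have hmul : A.IsLambdaOfAt (𝟙 _) D (L * L') (Θ + Θ') := IsLambdaOfAt.mul_add A D (𝟙 _) hD hΘ hΘ'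
  have hkill : ∀ P : (A.fibre (𝟙 _)).toAbelianVariety.Points ℂ, AlgPoints.map (fibreHom (L * L') (𝟙 _)).hom.hom.hom P = 1 := by
    intro P
    have hsum : fibreHom L (𝟙 _) + fibreHom L' (𝟙 _) = 0 := by rw [hor, neg_add_cancel]
    have h0 := AbelianVariety.comp_hom_hom_hom_zero (A := (A.fibre (𝟙 _)).toAbelianVariety) (B := (D.hat.fibre (𝟙 _)).toAbelianVariety) P
    rw [← hsum, AbelianVariety.hom_hom_hom_add, MonObj.comp_mul] at h0
    -- `(L·L′)_s = L_s + L′_s`, so it acts pointwise as the product of `L_s` and `L′_s`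
    have hfadd : fibreHom (L * L') (𝟙 (Spec (.of ℂ))) = fibreHom L (𝟙 _) + fibreHom L' (𝟙 _) := by
      apply AbelianVariety.hom_ext
      rw [AbelianVariety.hom_hom_hom_add]
      exact pullback_map_mul (𝟙 (Spec (.of ℂ))) L L'
    rw [hfadd, AbelianVariety.hom_hom_hom_add, AlgPoints.map_apply, MonObj.comp_mul]
    exact h0
  -- so the (finite) kernel of the ample witness `Θ + Θ′` is everything: `A_s(ℂ)` is finite
  have hfin : (Set.univ : Set ((A.fibre (𝟙 _)).toAbelianVariety.Points ℂ)).Finite :=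
    (hmul.finite_setOf_map_fibreHom_eq_one A D (𝟙 _) hamp).subset fun P _ => hkill P
  haveI : Finite ((A.fibre (𝟙 _)).toAbelianVariety.Points ℂ) := Set.finite_univ_iff.mp hfin
  -- hence `dim A_s = 0`: otherwise `#A_s[n] = n^{2 dim}` is unbounded
  have hdim : (A.fibre (𝟙 _)).toAbelianVariety.dim = 0 := by
    by_contra hd
    set c := Nat.card ((A.fibre (𝟙 _)).toAbelianVariety.Points ℂ) with hc
    have hcard := (A.fibre (𝟙 _)).toAbelianVariety.natCard_torsionPoints_eq_of_isAlgClosed ℂ ((c + 1 : ℕ) : ℤ)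
      (by exact_mod_cast Nat.succ_ne_zero c)
    have hle : Nat.card ((A.fibre (𝟙 _)).toAbelianVariety.torsionPoints ℂ ((c + 1 : ℕ) : ℤ)) ≤ c :=
      Nat.card_le_card_of_injective _ Subtype.val_injective
    rw [hcard, Int.natAbs_natCast] at hle
    have h1 : c + 1 ≤ (c + 1) ^ (2 * (A.fibre (𝟙 _)).toAbelianVariety.dim) :=
      Nat.le_self_pow (by omega) (c + 1)
    omega
  -- in dimension `0` every torsion point is trivial, so the two homomorphisms agree on torsion
  refine AbelianVariety.hom_eq_of_forall_torsionPoints_map _ _ fun n hn Q hQ => ?_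
  have hcard : Nat.card ((A.fibre (𝟙 _)).toAbelianVariety.torsionPoints ℂ (n : ℤ)) = 1 := by
    rw [(A.fibre (𝟙 _)).toAbelianVariety.natCard_torsionPoints_eq_of_isAlgClosed ℂ (n : ℤ) (by exact_mod_cast hn.ne'), hdim, mul_zero]
    simp
  haveI : Finite ((A.fibre (𝟙 _)).toAbelianVariety.torsionPoints ℂ (n : ℤ)) := Nat.finite_of_card_ne_zero (by rw [hcard]; exact one_ne_zero)
  have hsub : Subsingleton ((A.fibre (𝟙 _)).toAbelianVariety.torsionPoints ℂ (n : ℤ)) := (Nat.card_eq_one_iff_unique.mp hcard).1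
  have hQ1 : Q = 1 := congrArg Subtype.val (hsub.elim ⟨Q, hQ⟩ 1)
  rw [hQ1, AlgPoints.map_apply, AlgPoints.map_apply, MonObj.one_comp, MonObj.one_comp]

/-- **THE SIMILITUDE LAW READ ON TWO SYMPLECTIC TOWERS WITH INDEPENDENT ROOTS (over `ℂ`)** — the `hsim` binder of ★ `exists_roof_of_idealHomFamily_of_isAlgClosed` in the shape the L6
readings deliver: `h : A₁ → A₂` dominant with affine fibre map, `λᵢ = Λ(𝒪(Θᵢ))` at the point with `Θᵢ` AMPLE, `ν ≠ 0`, and for every level `N ∣ M ≠ 0` symplectic level maps `l₁ ↠ A₁[M](ℂ)`,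
`l₂ → A₂[M](ℂ)` with PRIMITIVE roots `ζ₁_M`, `ζ₂_M` (no relation assumed) and a reading `h(l₁ x) = l₂(T̄_M x)` of multiplier `ν`: THEN **`h ≫ λ₂ ≫ h^∨ = λ₁ ≫ [ν]`**.
[cite: MumfordAV1970, §19 Thm. 3 (p. 176), §20 (pp. 183–186), §23 (Thm. 2, p. 231)] [cite: Lan2013PELCompactifications, §1.3.6 Lemma 1.3.6.5 (p. 81)]
[cite: Lange2023AbelianVarietiesComplex, §2.4.1 Cor. 2.4.11 (PDF p. 117)] [cite: Lang1983AbelianVarieties, Ch. VII §2 Prop. 4] -/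
theorem comp_lam_comp_dualIsogenyOver_eq_mulN_of_towerReadings
    [IsDominant (AbelianVariety.Hom.toSchemeHom (fibreHom h (𝟙 (Spec (.of ℂ)))))]
    [IsAffineHom (AbelianVariety.Hom.toSchemeHom (fibreHom h (𝟙 (Spec (.of ℂ)))))]
    (D₁ : A₁.DualPair) (D₂ : A₂.DualPair)
    (hD₁ : Nonempty ((Scheme.Modules.pullback (DualPair.unitHatSlice D₁)).obj D₁.P ≅ SheafOfModules.unit _))
    (hD₂ : Nonempty ((Scheme.Modules.pullback (DualPair.unitHatSlice D₂)).obj D₂.P ≅ SheafOfModules.unit _))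
    (lam₁ : A₁.X ⟶ D₁.hat.X) (lam₂ : A₂.X ⟶ D₂.hat.X) [IsMonHom lam₁] [IsMonHom lam₂] {ν : ℕ} (hν : ν ≠ 0) {N : ℕ} (hN : N ≠ 0)
    {g' : ℕ} (δ : Fin g' → ℕ)
    {Θ₁ : CartierDivisor (A₁.fibre (𝟙 _)).toAbelianVariety.X.left} {Θ₂ : CartierDivisor (A₂.fibre (𝟙 _)).toAbelianVariety.X.left}
    (hΘ₁ : A₁.IsLambdaOfAt (𝟙 _) D₁ lam₁ Θ₁) (hΘ₂ : A₂.IsLambdaOfAt (𝟙 _) D₂ lam₂ Θ₂) (hamp₁ : Θ₁.IsAmple) (hamp₂ : Θ₂.IsAmple)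
    (ζ₁ ζ₂ : ℕ → ℂ) (hζ₁ : ∀ M, N ∣ M → M ≠ 0 → IsPrimitiveRoot (ζ₁ M) M) (hζ₂ : ∀ M, N ∣ M → M ≠ 0 → IsPrimitiveRoot (ζ₂ M) M)
    (l₁ : ∀ M : ℕ, (Fin g' ⊕ Fin g' → ZMod M) → (A₁.fibre (𝟙 _)).toAbelianVariety.torsionPoints ℂ M)
    (hl₁ : ∀ M, N ∣ M → M ≠ 0 → Function.Surjective (l₁ M))
    (l₂ : ∀ M : ℕ, (Fin g' ⊕ Fin g' → ZMod M) → (A₂.fibre (𝟙 _)).toAbelianVariety.torsionPoints ℂ M)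
    (he₁ : ∀ (M : ℕ), N ∣ M → ∀ (hMΩ : (M : ℂ) ≠ 0), haveI := (A₁.fibre (𝟙 _)).toAbelianVariety.isDominant_toSchemeHom_zsmul_of_ne_zero hMΩ
      ∀ x y, (A₁.fibre (𝟙 _)).toAbelianVariety.weilPairingLevel Θ₁ (l₁ M x) (l₁ M y) = ζ₁ M ^ (typeFormMod δ M x y).val)
    (he₂ : ∀ (M : ℕ), N ∣ M → ∀ (hMΩ : (M : ℂ) ≠ 0), haveI := (A₂.fibre (𝟙 _)).toAbelianVariety.isDominant_toSchemeHom_zsmul_of_ne_zero hMΩ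
      ∀ x y, (A₂.fibre (𝟙 _)).toAbelianVariety.weilPairingLevel Θ₂ (l₂ M x) (l₂ M y) = ζ₂ M ^ (typeFormMod δ M x y).val)
    (T : ∀ M : ℕ, (Fin g' ⊕ Fin g' → ZMod M) → (Fin g' ⊕ Fin g' → ZMod M))
    (hT : ∀ M, N ∣ M → M ≠ 0 → ∀ x, AlgPoints.map (fibreHom h (𝟙 _)).hom.hom.hom (l₁ M x).1 = (l₂ M (T M x)).1)
    (hνT : ∀ M, N ∣ M → M ≠ 0 → ∀ x y, typeFormMod δ M (T M x) (T M y) = (ν : ZMod M) * typeFormMod δ M x y) :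
    h ≫ lam₂ ≫ DualPair.dualIsogenyOver h D₁ D₂ = lam₁ ≫ D₁.hat.mulN ν := by
  -- instances and the two `Λ(𝒪(·))` homomorphisms `L = h ≫ λ₂ ≫ h^∨`, `L′ = λ₁ ≫ [ν]`
  haveI : IsCommMonObj D₁.hat.X := D₁.hat.isCommMonObj_of_isReduced_base
  haveI := DualPair.isMonHom_dualIsogenyOver h D₁ D₂ hD₂ hD₁
  haveI : IsMonHom (D₁.hat.mulN ν) := D₁.hat.isMonHom_mulN ν
  have hL : A₁.IsLambdaOfAt (𝟙 _) D₁ (h ≫ lam₂ ≫ DualPair.dualIsogenyOver h D₁ D₂)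
      (Θ₂.pullback (AbelianVariety.Hom.toSchemeHom (fibreHom h (𝟙 _)))) :=
    IsLambdaOfAt.pullback_dualIsogeny h D₁ D₂ (𝟙 _) lam₂ Θ₂ hΘ₂
  have hpow : A₁.IsLambdaOfAt (𝟙 _) D₁ (lam₁ ^ ν) (ν • Θ₁) := IsLambdaOfAt.pow_nsmul A₁ D₁ lam₁ (𝟙 _) ν hΘ₁
  have heq : lam₁ ^ ν = lam₁ ≫ D₁.hat.mulN ν := by rw [mulN_def, MonObj.comp_pow, Category.comp_id]
  rw [heq] at hpow
  -- (a) on every `A₁[M]`: `L(Q) = L′(Q)^{s_M}` with `s_M` coprime to `M` (`L = h ≫ λ₂ ≫ h^∨`, `L′ = λ₁ ≫ [ν]`)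
  have hscalar : ∀ M : ℕ, N ∣ M → M ≠ 0 → ∃ a : ℤ, IsCoprime a (M : ℤ) ∧
      ∀ P ∈ (A₁.fibre (𝟙 _)).toAbelianVariety.torsionPoints ℂ M,
        AlgPoints.map (fibreHom (h ≫ lam₂ ≫ DualPair.dualIsogenyOver h D₁ D₂) (𝟙 _)).hom.hom.hom P =
          AlgPoints.map (fibreHom (lam₁ ≫ D₁.hat.mulN ν) (𝟙 _)).hom.hom.hom P ^ a := by
    intro M hNM hM0
    have hMΩ : (M : ℂ) ≠ 0 := by exact_mod_cast hM0
    obtain ⟨s, hscop, hs⟩ := exists_coprime_root_pow_eq hM0 (hζ₁ M hNM hM0) (hζ₂ M hNM hM0)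
    refine ⟨(s : ℤ), Nat.isCoprime_iff_coprime.mpr hscop, fun P hP => ?_⟩
    have hpair := weilPairingLevel_map_eq_pow_mul_of_towerReading h hMΩ δ ν s (hζ₁ M hNM hM0).pow_eq_one (hζ₂ M hNM hM0).pow_eq_one hs
      Θ₁ Θ₂ (l₁ M) (hl₁ M hNM hM0) (l₂ M) (he₁ M hNM hMΩ) (he₂ M hNM hMΩ) (T M) (hT M hNM hM0) (hνT M hNM hM0)
    have hdiv := weilDiv_pullback_linEquiv_nsmul_pow_of_weilPairingLevel h ν s hMΩ Θ₁ Θ₂ ⟨P, hP⟩ (fun a => hpair a _)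
    have hval := valueAt_eq_valueAt_of_weilDiv_linEquiv₂ D₁ _ _ (𝟙 _) hL hpow P (P ^ s) hdiv
    have hpt := map_fibreHom_eq_map_fibreHom_of_valueAt_eq D₁ _ _ (𝟙 _) P (P ^ s) hval
    rw [zpow_natCast, hpt, AlgPoints.map_apply, AlgPoints.map_apply, MonObj.pow_comp]
  -- (b) `L′|_{A₁}` is an isogeny: `λ₁` has an ample witness, `[ν]` is an isogeny in characteristic `0`
  have hiso : AbelianVariety.IsIsogeny (fibreHom (lam₁ ≫ D₁.hat.mulN ν) (𝟙 _)) := by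
    rw [fibreHom_comp, fibreHom_mulN]
    exact AbelianVariety.isIsogeny_comp
      (hΘ₁.isIsogeny_fibreHom_of_isAmple_of_dim_eq A₁ D₁ (𝟙 _) hamp₁ (D₁.dim_fibre_eq_dim_hat_fibre (𝟙 _)))
      ((D₁.hat.fibre (𝟙 _)).toAbelianVariety.isIsogeny_zsmul_id_of_cast_ne_zero (ν : ℤ) (by exact_mod_cast hν))
  -- (c) torsion-scalar rigidity: `L|_{A₁} = ± L′|_{A₁}`; ampleness of `h^*Θ₂ + ν•Θ₁` excludes `−`
  have hor := HodgeTheory.AbelianVariety.eq_or_eq_neg_of_isIsogeny_of_forall_torsionPoints_map_eq_pow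
    (fibreHom (lam₁ ≫ D₁.hat.mulN ν) (𝟙 _)) (fibreHom (h ≫ lam₂ ≫ DualPair.dualIsogenyOver h D₁ D₂) (𝟙 _)) hiso hN hscalar
  have hamp : (Θ₂.pullback (AbelianVariety.Hom.toSchemeHom (fibreHom h (𝟙 _))) + ν • Θ₁).IsAmple :=
    (hamp₂.pullback _).add (hamp₁.smul (Nat.pos_of_ne_zero hν))
  have hfib := fibreHom_eq_of_fibreHom_eq_or_eq_neg_of_isAmple D₁ hD₁ _ _ hL hpow hamp hor
  -- (d) over `Spec ℂ` the identity fibre is everything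
  have hmap : (Over.pullback (𝟙 (Spec (.of ℂ)))).map (h ≫ lam₂ ≫ DualPair.dualIsogenyOver h D₁ D₂) =
      (Over.pullback (𝟙 (Spec (.of ℂ)))).map (lam₁ ≫ D₁.hat.mulN ν) := by
    rw [← fibreHom_hom_hom_hom, ← fibreHom_hom_hom_hom, hfib]
  haveI : (Over.pullback (𝟙 (Spec (CommRingCat.of ℂ)))).Faithful := Functor.Faithful.of_iso (overPullbackIdIso (Spec (.of ℂ))).symm
  exact (Over.pullback (𝟙 (Spec (.of ℂ)))).map_injective hmap

/-! ### §5 (ED. 2) The head with a UNIT-VALUED multiplier defect at every level -/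

/-- **(ED. 2) THE SAME HEAD WITH THE MULTIPLIER KNOWN ONLY UP TO A UNIT AT EACH LEVEL** — the shape the EHECKE assemblers actually meet: in the torsion coordinates of two
admissible readings the transporter `T̄_M = rep₂⁻¹·(p·T)·rep₁ (mod M)` is a symplectic similitude of multiplier `ν·u_M` with `u_M = ν(rep₁)ν(rep₂)⁻¹ ∈ (ℤ∕M)^×` a UNIT (the
representatives `rep (piece aᵢ)` of the two readings need not have the same adelic multiplier), exactly as the two root systems differ by a unit; both units are absorbed by the
same torsion-scalar rigidity: hypothesis `hνT` now asks `E_δ(T̄x, T̄y) = (u_M·ν)·E_δ(x, y)` for SOME `u_M` coprime to `M`.  Conclusion unchanged: `h ≫ λ₂ ≫ h^∨ = λ₁ ≫ [ν]`.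
[cite: MumfordAV1970, §19 Thm. 3 (p. 176), §20 (pp. 183–186), §23 (Thm. 2, p. 231)] [cite: Lan2013PELCompactifications, §1.3.6 Lemma 1.3.6.5 (p. 81)]
[cite: Lange2023AbelianVarietiesComplex, §2.4.1 Cor. 2.4.11 (PDF p. 117)] [cite: Milne2005ShimuraVarieties, §6 Thm. 6.11 p. 74 and p. 75] -/
theorem comp_lam_comp_dualIsogenyOver_eq_mulN_of_towerReadings_unit
    [IsDominant (AbelianVariety.Hom.toSchemeHom (fibreHom h (𝟙 (Spec (.of ℂ)))))]
    [IsAffineHom (AbelianVariety.Hom.toSchemeHom (fibreHom h (𝟙 (Spec (.of ℂ)))))]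
    (D₁ : A₁.DualPair) (D₂ : A₂.DualPair)
    (hD₁ : Nonempty ((Scheme.Modules.pullback (DualPair.unitHatSlice D₁)).obj D₁.P ≅ SheafOfModules.unit _))
    (hD₂ : Nonempty ((Scheme.Modules.pullback (DualPair.unitHatSlice D₂)).obj D₂.P ≅ SheafOfModules.unit _))
    (lam₁ : A₁.X ⟶ D₁.hat.X) (lam₂ : A₂.X ⟶ D₂.hat.X) [IsMonHom lam₁] [IsMonHom lam₂] {ν : ℕ} (hν : ν ≠ 0) {N : ℕ} (hN : N ≠ 0)
    {g' : ℕ} (δ : Fin g' → ℕ)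
    {Θ₁ : CartierDivisor (A₁.fibre (𝟙 _)).toAbelianVariety.X.left} {Θ₂ : CartierDivisor (A₂.fibre (𝟙 _)).toAbelianVariety.X.left}
    (hΘ₁ : A₁.IsLambdaOfAt (𝟙 _) D₁ lam₁ Θ₁) (hΘ₂ : A₂.IsLambdaOfAt (𝟙 _) D₂ lam₂ Θ₂) (hamp₁ : Θ₁.IsAmple) (hamp₂ : Θ₂.IsAmple)
    (ζ₁ ζ₂ : ℕ → ℂ) (hζ₁ : ∀ M, N ∣ M → M ≠ 0 → IsPrimitiveRoot (ζ₁ M) M) (hζ₂ : ∀ M, N ∣ M → M ≠ 0 → IsPrimitiveRoot (ζ₂ M) M)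
    (l₁ : ∀ M : ℕ, (Fin g' ⊕ Fin g' → ZMod M) → (A₁.fibre (𝟙 _)).toAbelianVariety.torsionPoints ℂ M)
    (hl₁ : ∀ M, N ∣ M → M ≠ 0 → Function.Surjective (l₁ M))
    (l₂ : ∀ M : ℕ, (Fin g' ⊕ Fin g' → ZMod M) → (A₂.fibre (𝟙 _)).toAbelianVariety.torsionPoints ℂ M)
    (he₁ : ∀ (M : ℕ), N ∣ M → ∀ (hMΩ : (M : ℂ) ≠ 0), haveI := (A₁.fibre (𝟙 _)).toAbelianVariety.isDominant_toSchemeHom_zsmul_of_ne_zero hMΩ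
      ∀ x y, (A₁.fibre (𝟙 _)).toAbelianVariety.weilPairingLevel Θ₁ (l₁ M x) (l₁ M y) = ζ₁ M ^ (typeFormMod δ M x y).val)
    (he₂ : ∀ (M : ℕ), N ∣ M → ∀ (hMΩ : (M : ℂ) ≠ 0), haveI := (A₂.fibre (𝟙 _)).toAbelianVariety.isDominant_toSchemeHom_zsmul_of_ne_zero hMΩ
      ∀ x y, (A₂.fibre (𝟙 _)).toAbelianVariety.weilPairingLevel Θ₂ (l₂ M x) (l₂ M y) = ζ₂ M ^ (typeFormMod δ M x y).val)
    (T : ∀ M : ℕ, (Fin g' ⊕ Fin g' → ZMod M) → (Fin g' ⊕ Fin g' → ZMod M))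
    (hT : ∀ M, N ∣ M → M ≠ 0 → ∀ x, AlgPoints.map (fibreHom h (𝟙 _)).hom.hom.hom (l₁ M x).1 = (l₂ M (T M x)).1)
    (hνT : ∀ M, N ∣ M → M ≠ 0 → ∃ u : ℕ, u.Coprime M ∧
      ∀ x y, typeFormMod δ M (T M x) (T M y) = ((u * ν : ℕ) : ZMod M) * typeFormMod δ M x y) :
    h ≫ lam₂ ≫ DualPair.dualIsogenyOver h D₁ D₂ = lam₁ ≫ D₁.hat.mulN ν := by
  -- instances and the two `Λ(𝒪(·))` homomorphisms `L = h ≫ λ₂ ≫ h^∨`, `L′ = λ₁ ≫ [ν]`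
  haveI : IsCommMonObj D₁.hat.X := D₁.hat.isCommMonObj_of_isReduced_base
  haveI := DualPair.isMonHom_dualIsogenyOver h D₁ D₂ hD₂ hD₁
  haveI : IsMonHom (D₁.hat.mulN ν) := D₁.hat.isMonHom_mulN ν
  have hL : A₁.IsLambdaOfAt (𝟙 _) D₁ (h ≫ lam₂ ≫ DualPair.dualIsogenyOver h D₁ D₂)
      (Θ₂.pullback (AbelianVariety.Hom.toSchemeHom (fibreHom h (𝟙 _)))) :=
    IsLambdaOfAt.pullback_dualIsogeny h D₁ D₂ (𝟙 _) lam₂ Θ₂ hΘ₂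
  have hpow : A₁.IsLambdaOfAt (𝟙 _) D₁ (lam₁ ^ ν) (ν • Θ₁) := IsLambdaOfAt.pow_nsmul A₁ D₁ lam₁ (𝟙 _) ν hΘ₁
  have heq : lam₁ ^ ν = lam₁ ≫ D₁.hat.mulN ν := by rw [mulN_def, MonObj.comp_pow, Category.comp_id]
  rw [heq] at hpow
  -- (a) on every `A₁[M]`: `L(Q) = L′(Q)^{s_M u_M}` with `s_M u_M` coprime to `M`
  have hscalar : ∀ M : ℕ, N ∣ M → M ≠ 0 → ∃ a : ℤ, IsCoprime a (M : ℤ) ∧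
      ∀ P ∈ (A₁.fibre (𝟙 _)).toAbelianVariety.torsionPoints ℂ M,
        AlgPoints.map (fibreHom (h ≫ lam₂ ≫ DualPair.dualIsogenyOver h D₁ D₂) (𝟙 _)).hom.hom.hom P =
          AlgPoints.map (fibreHom (lam₁ ≫ D₁.hat.mulN ν) (𝟙 _)).hom.hom.hom P ^ a := by
    intro M hNM hM0
    have hMΩ : (M : ℂ) ≠ 0 := by exact_mod_cast hM0
    obtain ⟨s, hscop, hs⟩ := exists_coprime_root_pow_eq hM0 (hζ₁ M hNM hM0) (hζ₂ M hNM hM0)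
    obtain ⟨u, hucop, hu⟩ := hνT M hNM hM0
    refine ⟨((s * u : ℕ) : ℤ), Nat.isCoprime_iff_coprime.mpr (Nat.Coprime.mul_left hscop hucop), fun P hP => ?_⟩
    have hpair := weilPairingLevel_map_eq_pow_mul_of_towerReading h hMΩ δ (u * ν) s (hζ₁ M hNM hM0).pow_eq_one (hζ₂ M hNM hM0).pow_eq_one hs
      Θ₁ Θ₂ (l₁ M) (hl₁ M hNM hM0) (l₂ M) (he₁ M hNM hMΩ) (he₂ M hNM hMΩ) (T M) (hT M hNM hM0) hu
    have hdiv := weilDiv_pullback_linEquiv_nsmul_pow_of_weilPairingLevel h ν (s * u) hMΩ Θ₁ Θ₂ ⟨P, hP⟩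
      (fun a => by rw [mul_assoc]; exact hpair a _)
    have hval := valueAt_eq_valueAt_of_weilDiv_linEquiv₂ D₁ _ _ (𝟙 _) hL hpow P (P ^ (s * u)) hdiv
    have hpt := map_fibreHom_eq_map_fibreHom_of_valueAt_eq D₁ _ _ (𝟙 _) P (P ^ (s * u)) hval
    rw [zpow_natCast, hpt, AlgPoints.map_apply, AlgPoints.map_apply, MonObj.pow_comp]
  -- (b) `L′|_{A₁}` is an isogeny
  have hiso : AbelianVariety.IsIsogeny (fibreHom (lam₁ ≫ D₁.hat.mulN ν) (𝟙 _)) := by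
    rw [fibreHom_comp, fibreHom_mulN]
    exact AbelianVariety.isIsogeny_comp
      (hΘ₁.isIsogeny_fibreHom_of_isAmple_of_dim_eq A₁ D₁ (𝟙 _) hamp₁ (D₁.dim_fibre_eq_dim_hat_fibre (𝟙 _)))
      ((D₁.hat.fibre (𝟙 _)).toAbelianVariety.isIsogeny_zsmul_id_of_cast_ne_zero (ν : ℤ) (by exact_mod_cast hν))
  -- (c) torsion-scalar rigidity and sign exclusion
  have hor := HodgeTheory.AbelianVariety.eq_or_eq_neg_of_isIsogeny_of_forall_torsionPoints_map_eq_pow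
    (fibreHom (lam₁ ≫ D₁.hat.mulN ν) (𝟙 _)) (fibreHom (h ≫ lam₂ ≫ DualPair.dualIsogenyOver h D₁ D₂) (𝟙 _)) hiso hN hscalar
  have hamp : (Θ₂.pullback (AbelianVariety.Hom.toSchemeHom (fibreHom h (𝟙 _))) + ν • Θ₁).IsAmple :=
    (hamp₂.pullback _).add (hamp₁.smul (Nat.pos_of_ne_zero hν))
  have hfib := fibreHom_eq_of_fibreHom_eq_or_eq_neg_of_isAmple D₁ hD₁ _ _ hL hpow hamp hor
  -- (d) over `Spec ℂ` the identity fibre is everything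
  have hmap : (Over.pullback (𝟙 (Spec (.of ℂ)))).map (h ≫ lam₂ ≫ DualPair.dualIsogenyOver h D₁ D₂) =
      (Over.pullback (𝟙 (Spec (.of ℂ)))).map (lam₁ ≫ D₁.hat.mulN ν) := by
    rw [← fibreHom_hom_hom_hom, ← fibreHom_hom_hom_hom, hfib]
  haveI : (Over.pullback (𝟙 (Spec (CommRingCat.of ℂ)))).Faithful := Functor.Faithful.of_iso (overPullbackIdIso (Spec (.of ℂ))).symm
  exact (Over.pullback (𝟙 (Spec (.of ℂ)))).map_injective hmap

end AbelianSchemeOver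

end Literature.AlgebraicGeometry.AbelianSchemes

end
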